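import Literature.Computability.Complexity.MurrayWilliams2018EasyWitness
import Literature.Computability.Complexity.UmansMain
import Literature.Computability.Complexity.KannanLanguage
import Literature.Computability.Complexity.TruncMapMachine
import Literature.Computability.Complexity.FinitePatching
import Literature.Computability.Complexity.NondeterministicProofs
import HarnessLib

/-!
# Murray–Williams 2018, Lemma 4.1: the literal all-lengths reading of `SIZE` holds vacuously;
# the almost-everywhere form `MurrayWilliams2018_lemma_4_1_ae` is discharged via Umans' generator

`MurrayWilliams2018EasyWitness.lean` vendors the Easy Witness Lemma for low nondeterministic time
(Murray–Williams 2018, Lemma 4.1) as the named fact `MurrayWilliams2018_lemma_4_1`, rendering its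
hypothesis "`NTIME[O(t(n)ᵉ)] ⊂ SIZE[s(n)]`" with the tree's class `SIZE s` of `CircuitClasses.lean`
— a `B₂`-circuit of size `≤ s n` at EVERY length `n` — which is the paper's own wording (§2:
"We use `SIZE[s(n)]` to denote the class of problems computed by a (non-uniform) `s(n)`-size
circuit family"). Read literally, that hypothesis can never hold: for `e ≥ 2` and every `s` with
proviso (a), `n · s(n) < 2^{n/e}` for all large `n`, some length `n` has
`(s(n)+1)(8(n+s(n))+10) + 1 ≤ 2ⁿ`, so by counting circuit DESCRIPTIONS (Kannan 1982, Lemma 0, in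
the form of `KannanLanguage.lean`: every `B₂`-circuit of size `≤ S` on `n` inputs has a description
of length `≤ (S+1)(8(n+S)+10)`, `CircEval.length_desc_le`) some table `T` on the inputs of length
`n` is matched by no circuit of size `≤ s(n)` (`exists_isHardTable`), and the FINITE language
`tableLang n T = {x : |x| = n, T[bitsToNat x] = 1}` lies in `NTIME u` for every `u ≥ id`
(`mem_NTIME_of_forall_length_le`: a finite-state verifier ignoring its certificate) — in particular
in `NTIME (t · ^ e)` — but not in `SIZE s` (`tableLang_not_mem_SIZE`). Hence
`¬ (NTIME u ⊆ SIZE s)` (`not_NTIME_subset_SIZE`) and **`MurrayWilliams2018_lemma_4_1_holds`**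
follows with `e = 2`, `g = d = 1`, VACUOUSLY.

This discharge therefore carries none of the mathematical content of Lemma 4.1 (Umans' generator,
the Merlin–Arthur lower bound of Thm. 3.1, …); it records that the literal statement is too weak to
be worth more. The contentful reading — the assumed circuits are used only at the large lengths of
the bad inputs, i.e. the hypothesis is almost-everywhere, `∀ L ∈ NTIME (t · ^ e), ∀ᶠ n,
L.circuitSize n ≤ s n` — is the named fact `MurrayWilliams2018_lemma_4_1_ae` of the same file,
DISCHARGED at the end of this file (`MurrayWilliams2018_lemma_4_1_ae_holds`) through the tree's
closer `MurrayWilliams2018_lemma_4_1_ae_of_umansGenerator` (`TVHardness.lean`: the Merlin–Arthur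
lower bound of Thm. 3.1, the advice-taking nondeterministic simulation and the easy-witness
counting, given a generator of Umans' type) applied to `UmansFP.umansGenerator` (`UmansMain.lean`:
C. Umans, JCSS 67 (2003), Thm. 6, formalized in the `Umans*.lean` files). (It also carries the
printed hypothesis "increasing `t`", `Monotone t`, which the literal form omits, so it yields the
literal all-lengths form for monotone `t` only, `MurrayWilliams2018_lemma_4_1_ae.size_form`; see
the review section of that file.) The same
remark applies verbatim to the paper's "`NP ⊂ SIZE[nᵏ]`" (Lemma 1.2): finite
languages with one hard slice are in `P`, so the intended reading is up to finitely many lengths.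

## Contents

* `PrefixFST.prefT m out` — the finite-state transducer (`Transducers.lean`) that stores the first
  `m` input bits in its state (the state space `Patch.PState m` of `FinitePatching.lean`) and
  outputs `out (w ↾ m)`; it emits nothing while reading (`maxEmit = 0`), so its machine runs in
  time `n + 3` (`PrefixFST.exists_outputsWithin`).
* `mem_NTIME_of_forall_length_le`, `mem_NTIME_of_finite` — a language all of whose words have
  length `≤ n₀` is in `NTIME u` whenever `u n ≥ n`: the verifier is the truncating wrapper
  `truncMapAux` (`TruncMapMachine.lean`, discarding the whole certificate two symbols per step) of
  the clock `x ↦ ⟨x ↾ (n₀+1), ε⟩`, followed by the table `a ↦ [a ↾ (n₀+1) ∈ L]` behind the pair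
  projection (`boolUnpairFstLift`); constant `2 (6 n₀ + 31)`.
* `IsHardTable`, `exists_isHardTable` — Kannan's counting lemma at a general description budget
  `m` with `m + 1 ≤ 2ⁿ` (the proof of `Kannan.exists_isHard`, which is the case `m = n^{2k+2}`).
* `tableLang`, `tableLang_not_mem_SIZE`, `not_NTIME_subset_SIZE`, `exists_descBudget_le`,
  `MurrayWilliams2018_lemma_4_1_holds`.
* `MurrayWilliams2018_lemma_4_1_ae_holds` — **the almost-everywhere form (Lemma 4.1 proper),
  discharged** from `UmansFP.umansGenerator` (Umans 2003, Thm. 6) and the closer of `TVHardness.lean`.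

## References

* C. D. Murray, R. R. Williams, *Circuit lower bounds for nondeterministic quasi-polytime: an easy
  witness lemma for NP and NQP*, STOC 2018, §2 ("SIZE[s(n)]"), Thm. 2.3, Thm. 3.1, Lemma 4.1
  [MurrayWilliams2018].
* C. Umans, *Pseudo-random generators for all hardnesses*, JCSS 67 (2003), Thm. 6 [Umans2003].
* R. Kannan, *Circuit-size lower bounds and non-reducibility to sparse sets*, Inform. Control 55
  (1982) 40–56, Lemma 0 (counting) [Kannan1982].
* S. Arora, B. Barak, *Computational Complexity: A Modern Approach*, CUP 2009, Def. 2.1 and §1.3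
  (verifier form, several symbols per step), Def. 6.2 and Thm. 6.21 (size classes, hard functions
  exist) [AroraBarak2009].
-/

namespace Literature.Computability.Complexity

open Filter _root_.Computability Turing CircEval

/-! ### The prefix-storing transducer -/

namespace PrefixFST

variable {m : ℕ} {out : List Bool → List Bool}

/-- **The prefix-storing transducer**: reading its input once, it stores the first `m` bits in its
state (`Patch.PState.pushBit`, saturating at `m`), emits nothing, and at the end outputs
`out` of the stored prefix. [folklore] -/
def prefT (m : ℕ) (out : List Bool → List Bool) : FST (Patch.PState m) Bool Bool where
  init := ⟨false, none, 0, fun _ => false⟩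
  step s a := (s.pushBit a, [])
  front s := out s.pref
  keep _ := false

/-- The transition of `prefT`: store the bit, emit nothing. [folklore] -/
@[simp] theorem prefT_step (s : Patch.PState m) (a : Bool) :
    (prefT m out).step s a = (s.pushBit a, []) := rfl

/-- The final output of `prefT` is `out` of the stored prefix. [folklore] -/
@[simp] theorem prefT_front (s : Patch.PState m) : (prefT m out).front s = out s.pref := rfl

/-- `prefT` discards its (empty) emitted body. [folklore] -/
@[simp] theorem prefT_keep (s : Patch.PState m) : (prefT m out).keep s = false := rfl

/-- The initial state stores the empty prefix. [folklore] -/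
theorem pref_init : (prefT m out).init.pref = [] := by
  simp [Patch.PState.pref, prefT]

/-- At saturation `pushBit` does not change the stored prefix. [folklore] -/
theorem pushBit_pref_of_le (s : Patch.PState m) (a : Bool) (h : m ≤ (s.cnt : ℕ)) :
    (s.pushBit a).pref = s.pref := by
  unfold Patch.PState.pushBit
  rw [dif_neg (by omega)]
  rfl

/-- **Running the prefix-storing transducer** from a state `s` on `w`: nothing is emitted, the
count becomes `min m (cnt + |w|)`, and the stored prefix is extended by the first `m - cnt` bits
of `w`. [folklore] -/
theorem run_prefT (w : List Bool) : ∀ s : Patch.PState m,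
    ((prefT m out).run s w).2 = [] ∧
      (((prefT m out).run s w).1.cnt : ℕ) = min m (s.cnt + w.length) ∧
        ((prefT m out).run s w).1.pref = s.pref ++ w.take (m - s.cnt) := by
  induction w with
  | nil =>
    intro s
    have := s.cnt.isLt
    refine ⟨rfl, ?_, ?_⟩
    · simp only [FST.run_nil, List.length_nil, add_zero]; omega
    · simp
  | cons a w ih =>
    intro s
    rw [FST.run_cons, prefT_step]
    obtain ⟨h1, h2, h3⟩ := ih (s.pushBit a)
    refine ⟨by simpa using h1, ?_, ?_⟩
    · rw [h2]
      by_cases hc : (s.cnt : ℕ) < m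
      · rw [(Patch.pushBit_pref s a hc).1]; simp only [List.length_cons]; omega
      · rw [Patch.pushBit_cnt_of_le s a (by omega)]; simp only [List.length_cons]; omega
    · rw [h3]
      by_cases hc : (s.cnt : ℕ) < m
      · obtain ⟨hc1, hc2⟩ := Patch.pushBit_pref s a hc
        rw [hc1, hc2, List.append_assoc,
          show m - (s.cnt : ℕ) = (m - (s.cnt + 1)) + 1 by omega, List.take_succ_cons]
        rfl
      · rw [Patch.pushBit_cnt_of_le s a (by omega), pushBit_pref_of_le s a (by omega),
          show m - (s.cnt : ℕ) = 0 by omega, List.take_zero, List.take_zero]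

/-- **The transduction of `prefT`** is `out` of the first `m` input bits. [folklore] -/
theorem prefT_eval (w : List Bool) : (prefT m out).eval w = out (w.take m) := by
  obtain ⟨-, -, h3⟩ := run_prefT (m := m) (out := out) w (prefT m out).init
  have h0 : ((prefT m out).init.cnt : ℕ) = 0 := rfl
  rw [h0, pref_init, List.nil_append, Nat.sub_zero] at h3
  rw [FST.eval, prefT_front, prefT_keep, h3]
  simp

/-- `prefT` emits nothing per symbol: `maxEmit = 0`. [folklore] -/
theorem maxEmit_prefT : (prefT m out).maxEmit = 0 :=
  Nat.eq_zero_of_le_zero (Finset.sup_le fun p _ => by simp)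

/-- **A linear-time machine for `w ↦ out (w ↾ m)`**: the transducer machine of `prefT`
(`FST.timeComputable_eval`) runs in time `n + 3`. [folklore] -/
theorem exists_outputsWithin (m : ℕ) (out : List Bool → List Bool) :
    ∃ M : TM2ComputableAux Bool Bool, ∀ w : List Bool,
      M.OutputsWithin w (out (w.take m)) (w.length + 3) := by
  obtain ⟨M, hM⟩ := (prefT m out).timeComputable_eval
  refine ⟨M, fun w => ?_⟩
  have h := hM w
  rw [maxEmit_prefT] at h
  change M.OutputsWithin w ((prefT m out).eval w) ((0 + 1) * w.length + 3) at h
  rwa [prefT_eval, Nat.zero_add, Nat.one_mul] at h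

end PrefixFST

/-! ### Finite languages are in every `NTIME u` with `u n ≥ n` -/

/-- Deciding a language of words of length `≤ n₀` only needs the first `n₀ + 1` bits.
[folklore] -/
theorem boolIndicator_take_succ_eq {L : Language Bool} {n₀ : ℕ} (hL : ∀ x ∈ L, x.length ≤ n₀)
    (x : List Bool) : L.boolIndicator (x.take (n₀ + 1)) = L.boolIndicator x := by
  by_cases hx : x.length ≤ n₀
  · rw [List.take_of_length_le (by omega)]
  · have h1 : x ∉ L := fun h => hx (hL x h)
    have h2 : x.take (n₀ + 1) ∉ L := fun h => by
      have := hL _ h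
      rw [List.length_take] at this
      omega
    rw [(Set.notMem_iff_boolIndicator _ _).1 h1, (Set.notMem_iff_boolIndicator _ _).1 h2]

/-- **A language of words of bounded length is in `NTIME u` for every `u` with `u n ≥ n`**
(Arora–Barak 2009, Def. 2.1 with §1.3: a finite table in the finite control; in the tree's
one-constant verifier form the certificate must be discarded two symbols per step). The verifier
on `⟨x, y⟩`: the truncating wrapper `truncMapAux` of the linear-time clock `x ↦ ⟨x ↾ (n₀+1), ε⟩`
(`PrefixFST.exists_outputsWithin`) — output `⟨x ↾ (n₀+1), ε⟩` within `3|x| + |y|/2 + O(n₀)` steps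
— followed by the linear-time table `a ↦ [a ↾ (n₀+1) ∈ L]` behind the pair projection
(`boolUnpairFstLift`); the relation is `R x y = [x ∈ L]`, the empty certificate suffices, and the
constant is `2 (6 n₀ + 31)`. [cite: AroraBarak2009, Def. 2.1 and §1.3] -/
theorem mem_NTIME_of_forall_length_le {L : Language Bool} {n₀ : ℕ}
    (hL : ∀ x ∈ L, x.length ≤ n₀) {u : ℕ → ℕ} (hu : ∀ n, n ≤ u n) : L ∈ NTIME u := by
  classical
  obtain ⟨N, hN⟩ := PrefixFST.exists_outputsWithin (n₀ + 1) (fun p => boolPair p [])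
  obtain ⟨M, hM⟩ :=
    PrefixFST.exists_outputsWithin (n₀ + 1) (fun p => encodeBool (L.boolIndicator p))
  set C₀ : ℕ := 6 * n₀ + 31 with hC₀
  refine ⟨2 * C₀, fun x _ => L.boolIndicator x, (truncMapAux N).comp (boolUnpairFstLift M),
    fun x y hy => ?_, fun x => ?_⟩
  · -- running time
    have h₁ := outputsWithin_truncMapAux_boolPair N (y := y) (hN x)
    simp only [List.length_nil, List.take_zero, mul_zero, add_zero] at h₁
    have hMa := hM (x.take (n₀ + 1))
    rw [List.take_take, min_self, boolIndicator_take_succ_eq hL x] at hMa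
    have h₂ : (boolUnpairFstLift M).OutputsWithin (boolPair (x.take (n₀ + 1)) [])
        (encodeBool (L.boolIndicator x))
        ((x.take (n₀ + 1)).length + 3 +
          ((boolPair (x.take (n₀ + 1)) ([] : List Bool)).length + 3)) := by
      refine outputsWithin_boolUnpairFstLift M ?_
      simpa using hMa
    have h := Turing.TM2ComputableAux.comp_outputsWithin _ _ h₁ h₂
    refine h.mono ?_
    have ht : (x.take (n₀ + 1)).length ≤ n₀ + 1 := List.length_take_le _ _
    have hl : (boolPair (x.take (n₀ + 1)) ([] : List Bool)).length =
        2 * (x.take (n₀ + 1)).length + 2 := by simp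
    rw [hl]
    have hux := hu x.length
    have e3 : 3 * u x.length ≤ C₀ * u x.length := Nat.mul_le_mul_right _ (by omega)
    have hassoc : 2 * C₀ * u x.length = 2 * (C₀ * u x.length) := by ring
    rw [hassoc] at hy ⊢
    omega
  · -- correctness: the empty certificate
    have hiff : x ∈ L ↔ L.boolIndicator x = true :=
      Set.mem_iff_boolIndicator (L : Set (List Bool)) x
    exact ⟨fun h => ⟨[], Nat.zero_le _, hiff.1 h⟩, fun ⟨_, _, h⟩ => hiff.2 h⟩

/-- **Finite languages are in `NTIME u` for every `u` with `u n ≥ n`.**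
[cite: AroraBarak2009, Def. 2.1 and §1.3] -/
theorem mem_NTIME_of_finite {L : Language Bool} (hL : L.Finite) {u : ℕ → ℕ} (hu : ∀ n, n ≤ u n) :
    L ∈ NTIME u := by
  obtain ⟨n₀, hn₀⟩ := (hL.image List.length).bddAbove
  exact mem_NTIME_of_forall_length_le (fun x hx => hn₀ ⟨x, hx, rfl⟩) hu

/-! ### Hard tables at a general description budget -/

/-- **`T` is a hard table at length `n` for the description budget `m`**: `T` has length `m + 1`
and every description `D` of length `≤ m` (read by the evaluator of `CircuitEval.lean`,
`Kannan.descAccepts`) errs on some live input `y 0^{n-|y|}`, `|y| ≤ n`, `bitsToNat y ≤ m`, against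
the entry `T[bitsToNat y]`. (`Kannan.IsHard k n` is the case `m = n^{2k+2}`.)
[cite: Kannan1982, Lemma 0] -/
def IsHardTable (n m : ℕ) (T : List Bool) : Prop :=
  T.length = m + 1 ∧
    ∀ D : List Bool, D.length ≤ m →
      ∃ y : List Bool, y.length ≤ n ∧ bitsToNat y ≤ m ∧
        Kannan.descAccepts D (Kannan.pad n y) ≠ T.getD (bitsToNat y) false

/-- **Counting lemma** (Kannan 1982, Lemma 0, description form, general budget): if
`m + 1 ≤ 2ⁿ` then some table of length `m + 1` is hard at length `n` for the budget `m`.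
Otherwise every table `ofFn f` is matched on all live inputs by a description `D(f)` of length
`≤ m`, and `f ↦ code (D f)` (`Kannan.code`: `D 1 0^{m-|D|}`) is an injective self-map of
`Fin (m+1) → Bool` — two tables with the same description agree at every address `i ≤ m < 2ⁿ`,
addressed by `bitsOf n i` — hence surjective, yet no code is all-zero. (Verbatim the proof of
`Kannan.exists_isHard`.) [cite: Kannan1982, Lemma 0] -/
theorem exists_isHardTable (n m : ℕ) (hm : m + 1 ≤ 2 ^ n) : ∃ T, IsHardTable n m T := by
  classical
  by_contra hno
  push Not at hno
  have hmatch : ∀ f : Fin (m + 1) → Bool, ∃ D : List Bool, D.length ≤ m ∧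
      ∀ y : List Bool, y.length ≤ n → bitsToNat y ≤ m →
        Kannan.descAccepts D (Kannan.pad n y) = (List.ofFn f).getD (bitsToNat y) false := by
    intro f
    have h := hno (List.ofFn f)
    simp only [IsHardTable, List.length_ofFn, true_and, not_forall, not_exists, not_and, not_not,
      exists_prop] at h
    obtain ⟨D, hD, hagree⟩ := h
    exact ⟨D, hD, fun y hy hv => hagree y hy hv⟩
  choose D hD hagree using hmatch
  let G : (Fin (m + 1) → Bool) → (Fin (m + 1) → Bool) := fun f => Kannan.code m (D f)
  have hG : Function.Injective G := by
    intro f₁ f₂ hf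
    have hDD : D f₁ = D f₂ := Kannan.code_injective (hD f₁) (hD f₂) hf
    funext ⟨i, hi⟩
    have hi2 : i < 2 ^ n := lt_of_lt_of_le hi hm
    have hy : (Kannan.bitsOf n i).length ≤ n := by simp
    have hv : bitsToNat (Kannan.bitsOf n i) ≤ m := by
      rw [Kannan.bitsToNat_bitsOf n i hi2]; omega
    have a₁ := hagree f₁ (Kannan.bitsOf n i) hy hv
    have a₂ := hagree f₂ (Kannan.bitsOf n i) hy hv
    rw [Kannan.bitsToNat_bitsOf n i hi2, Kannan.getD_ofFn _ hi] at a₁ a₂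
    rw [← a₁, ← a₂, hDD]
  obtain ⟨f, hf⟩ := (Finite.injective_iff_surjective.1 hG) fun _ => false
  have h1 : G f ⟨(D f).length, Nat.lt_succ_of_le (hD f)⟩ = true := Kannan.code_apply_length (hD f)
  rw [hf] at h1
  exact Bool.false_ne_true h1

/-! ### The table language and the unsatisfiable hypothesis -/

/-- **The table language** of a table `T` at length `n`: the words `x` of length exactly `n` with
`T[bitsToNat x] = 1` — a finite language whose only nonempty slice is read off `T`. [folklore] -/
def tableLang (n : ℕ) (T : List Bool) : Language Bool :=
  {x | x.length = n ∧ T.getD (bitsToNat x) false = true}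

/-- Unfolding membership in `tableLang n T`. [folklore] -/
theorem mem_tableLang {n : ℕ} {T x : List Bool} :
    x ∈ tableLang n T ↔ x.length = n ∧ T.getD (bitsToNat x) false = true :=
  Iff.rfl

/-- Consistency of a deciding family with the table: if the `B₂`-family `C` decides
`tableLang n T`, then on a word `z` of length `n` the description of `C_n` accepts `z` iff
`T[bitsToNat z] = 1` (cf. `Kannan.descAccepts_desc_eq_getD`). [cite: Kannan1982, Lemma 1 (proof)] -/
theorem descAccepts_desc_eq_getD_of_decides {n : ℕ} {T : List Bool} {C : CircuitFamily}
    (hC : ∀ k, (C k).IsOver B2) (hdec : C.Decides (tableLang n T)) (z : List Bool)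
    (hz : z.length = n) :
    Kannan.descAccepts (desc (C z.length)) z = T.getD (bitsToNat z) false := by
  rw [Kannan.descAccepts_desc z (C z.length) (hC z.length), hdec z]
  by_cases hzL : z ∈ tableLang n T
  · rw [(Set.mem_iff_boolIndicator _ _).1 hzL, hzL.2]
  · rw [(Set.notMem_iff_boolIndicator _ _).1 hzL]
    have : ¬ T.getD (bitsToNat z) false = true := fun h => hzL ⟨hz, h⟩
    simpa using this

/-- **A hard table defeats every small family**: if `T` is hard at length `n` for a budget `m`
covering the descriptions of circuits of size `≤ s n`, i.e. `(s n + 1)(8(n + s n) + 10) ≤ m`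
(`Kannan.length_desc_le_of_size_le`), then `tableLang n T ∉ SIZE s` — the description of the
`n`-th circuit of a deciding family is diagonalised against on a live input.
[cite: Kannan1982, Lemma 1 (proof)] -/
theorem tableLang_not_mem_SIZE {n m : ℕ} {T : List Bool} (hT : IsHardTable n m T) {s : ℕ → ℕ}
    (hs : (s n + 1) * (8 * (n + s n) + 10) ≤ m) : tableLang n T ∉ SIZE s := by
  rintro ⟨C, hC, hdec⟩
  have hD : (desc (C n)).length ≤ m := (Kannan.length_desc_le_of_size_le (C n) (hC n).2).trans hs
  obtain ⟨y, hy, -, hne⟩ := hT.2 (desc (C n)) hD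
  apply hne
  have hlen : (Kannan.pad n y).length = n := Kannan.length_pad hy
  have key := descAccepts_desc_eq_getD_of_decides (fun k => (hC k).1) hdec (Kannan.pad n y) hlen
  rw [hlen] at key
  rw [key, Kannan.bitsToNat_pad]

/-- **No class `NTIME u` with `u n ≥ n` is contained in an all-lengths size class `SIZE s` once
some length `n` satisfies `(s n + 1)(8(n + s n) + 10) + 1 ≤ 2ⁿ`**: the table language of a hard
table at that length is a finite language in `NTIME u` (`mem_NTIME_of_forall_length_le`) outside
`SIZE s` (`tableLang_not_mem_SIZE`). (Arora–Barak 2009, Thm. 6.21: functions of circuit complexity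
near `2ⁿ/n` exist at every large length; here via Kannan's description counting.) [folklore] -/
theorem not_NTIME_subset_SIZE {u s : ℕ → ℕ} (hu : ∀ n, n ≤ u n) {n : ℕ}
    (hn : (s n + 1) * (8 * (n + s n) + 10) + 1 ≤ 2 ^ n) : ¬ (NTIME u ⊆ SIZE s) := by
  intro hsub
  obtain ⟨T, hT⟩ := exists_isHardTable n _ hn
  have hmem : tableLang n T ∈ NTIME u :=
    mem_NTIME_of_forall_length_le (n₀ := n) (fun x hx => hx.1.le) hu
  exact tableLang_not_mem_SIZE hT le_rfl (hsub hmem)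

/-- **Proviso (a) of Lemma 4.1 with `e = 2` makes the description budget fit**: if `s` is strictly
increasing and `n · s(n) < 2^{n/2}` for all large `n`, then at some length
`(s n + 1)(8(n + s n) + 10) + 1 ≤ 2ⁿ` (at any such `n ≥ 8`: the left side is `≤ 64 s(n)² ≤ (n s(n))²
< (2^{n/2})² ≤ 2ⁿ`, using `n ≤ s n`). [folklore] -/
theorem exists_descBudget_le {s : ℕ → ℕ} (hs : StrictMono s)
    (ha : ∀ᶠ n in atTop, n * s n < 2 ^ (n / 2)) :
    ∃ n, (s n + 1) * (8 * (n + s n) + 10) + 1 ≤ 2 ^ n := by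
  obtain ⟨N, hN⟩ := eventually_atTop.1 ha
  refine ⟨max N 8, ?_⟩
  set n := max N 8 with hn
  have h8 : 8 ≤ n := le_max_right _ _
  have hlt := hN n (le_max_left _ _)
  have hS : n ≤ s n := hs.id_le n
  have h1 : (n * s n) * (n * s n) < 2 ^ (n / 2) * 2 ^ (n / 2) := Nat.mul_lt_mul'' hlt hlt
  have h2 : 2 ^ (n / 2) * 2 ^ (n / 2) ≤ 2 ^ n := by
    rw [← pow_add]
    exact Nat.pow_le_pow_right (by norm_num) (by omega)
  have h3 : (s n + 1) * (8 * (n + s n) + 10) + 1 ≤ 64 * (s n * s n) := by nlinarith [hS, h8]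
  have h4 : 64 * (s n * s n) ≤ (n * s n) * (n * s n) := by
    have h64 : 64 ≤ n * n := Nat.mul_le_mul h8 h8
    calc 64 * (s n * s n) ≤ (n * n) * (s n * s n) := Nat.mul_le_mul_right _ h64
      _ = (n * s n) * (n * s n) := by ring
  calc (s n + 1) * (8 * (n + s n) + 10) + 1 ≤ 64 * (s n * s n) := h3
    _ ≤ (n * s n) * (n * s n) := h4
    _ ≤ 2 ^ (n / 2) * 2 ^ (n / 2) := h1.le
    _ ≤ 2 ^ n := h2

/-! ### Discharge of `MurrayWilliams2018_lemma_4_1` (vacuous in the literal reading) -/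

/-- **Discharge of the named fact `MurrayWilliams2018_lemma_4_1`** (Murray–Williams 2018,
Lemma 4.1, as vendored with the ALL-LENGTHS class `SIZE s`). With `e = 2`, `g = d = 1`: for every
strictly increasing `s` with proviso (a) and every time-constructible `t` (so `t n ≥ n`, hence
`t(n)² ≥ n`), the hypothesis `NTIME (t · ^ 2) ⊆ SIZE s` is refuted by `not_NTIME_subset_SIZE` at
the length supplied by `exists_descBudget_le`, so the implication holds VACUOUSLY. This is not the
printed proof and carries none of its content; the contentful (almost-everywhere) form of the
lemma is the named fact `MurrayWilliams2018_lemma_4_1_ae`, discharged below as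
`MurrayWilliams2018_lemma_4_1_ae_holds`. [cite: MurrayWilliams2018, Lemma 4.1] -/
theorem MurrayWilliams2018_lemma_4_1_holds : MurrayWilliams2018_lemma_4_1 := by
  refine ⟨2, 1, 1, by norm_num, le_rfl, le_rfl, ?_⟩
  intro s t hs _ ht ha _ hsub
  obtain ⟨n, hn⟩ := exists_descBudget_le hs ha
  have hu : ∀ k, k ≤ t k ^ 2 := fun k => (ht.1 k).trans (Nat.le_self_pow (by norm_num) _)
  exact absurd hsub (not_NTIME_subset_SIZE hu hn)

/-! ### The almost-everywhere form (Lemma 4.1 proper) — discharged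

The contentful named fact `MurrayWilliams2018_lemma_4_1_ae` is proved through the tree's closer
`MurrayWilliams2018_lemma_4_1_ae_of_umansGenerator` (`TVHardness.lean`: the nondeterministic
simulation + the easy-witness counting, given a generator of Umans' type) applied to the generator
`UmansFP.umansGenerator` (`UmansMain.lean`: C. Umans, JCSS 67 (2003), Thm. 6, formalized in the
`Umans*.lean` files). -/

/-- **Murray–Williams' Lemma 4.1 (almost-everywhere form) holds.**
[cite: MurrayWilliams2018, Lemma 4.1; Umans2003, Thm. 6] -/
theorem MurrayWilliams2018_lemma_4_1_ae_holds : MurrayWilliams2018_lemma_4_1_ae :=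
  MurrayWilliams2018_lemma_4_1_ae_of_umans

end Literature.Computability.Complexity
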